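import Summits.CriticalPhenomena.PercolationContinuityZ3.Theorems.PercNearOneGluingNoHeavyLowerTailSuffices
import Summits.CriticalPhenomena.PercolationContinuityZ3.Theorems.PercNearOneGluingNoHeavyLowerTailHalfLeSevenForms
import HarnessLib

/-!
# `NoHeavyLowerTail` (stmt-CriticalPhenomena-4575), line fat-minority-linear — counting lemmas

First-moment counting for the registered stub `stub_fatMinorityLinear`

  `FML :  ∃ d₀ C, 0 ≤ C ∧ ∀ (graph, A, o ∉ A, η ≥ max_{a,a' ∈ A} P(a ↮ a')),`
  `        P(d₀ < N ∧ 2N ≤ |A|) ≤ C · (P(o ↮ A) + η),        N = #{a ∈ A : o ↔ a}`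

(`N` = number of relays joined to the observer `o`; `FML ⇒ NoHeavyLowerTail` is the landed
`noHeavyLowerTail_of_fatMinorityLinear`).  Contents (sorry-free, elementary):

* `halfLeSevenForms_mul_measureReal_le_sum_inter` — `c · μ(S) ≤ ∑_k μ(S ∩ E_k)` when every point of `S` lies in
  at least `c` of the `E_k` (finite Markov inequality over an arbitrary finite index).
* `fatMinority_halfCard_mul_le` — Markov for the missed count: `(|A|/2) · P(2N ≤ |A|) ≤ ∑_a P(o ↮ a)`;
  `fatMinority_le_minority`, `minority_le_two_mul` — bookkeeping corollaries.
* `card_connPairs_eq`, `fatMinority_pairCount` — PAIR COUNTING: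
  `P(d₀ < N ∧ 2N ≤ |A|) ≤ (2|A|/(d₀+1)) · η`.  On the event there are `N(|A| − N) ≥ (d₀+1)|A|/2`
  ordered pairs of relays `(a, a')` with `o ↔ a`, `o ↮ a'`, each a disconnected pair, while
  `∑_{a,a'} P(a ↮ a') ≤ |A|² η`.  So the stub holds with constant `2K` on every class of relay
  sets with `|A| ≤ K(d₀+1)`: its whole content is the regime `|A| ≫ d₀` (many relays, a fat but
  thin minority), in line with `Cruxes/NoHeavyLowerTail/Disproof.lean §E`.
-/

noncomputable section

namespace Summit.CriticalPhenomena.PercolationContinuityZ3.Theorems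

open MeasureTheory Set Literature.Probability.LatticeModels Literature.Probability.Percolation
open Summit.CriticalPhenomena.PercolationContinuityZ3.Theses.PercNearOneGluing
open scoped Classical BigOperators

/-! ## Markov for the missed count -/

/-- **Markov for the missed count.** `(|A|/2) · P(2N ≤ |A|) ≤ ∑_{a ∈ A} P(o ↮ a)`, where
`N = #{a ∈ A : o ↔ a}`: on `{2N ≤ |A|}` at least `|A|/2` relays are missed. [folklore] -/
theorem fatMinority_halfCard_mul_le {n : ℕ} (w : Sym2 (Fin n) → unitInterval)
    (A : Finset (Fin n)) (o : Fin n) :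
    ((A.card : ℝ) / 2) * (prodBernoulli w).real {ω : BondConfig (Fin n) |
        2 * (A.filter fun a => ω ∈ openConn o a).card ≤ A.card} ≤
      ∑ a ∈ A, (prodBernoulli w).real (openConn o a : Set (BondConfig (Fin n)))ᶜ := by
  have hmeas : ∀ s : Set (BondConfig (Fin n)), MeasurableSet s :=
    fun _ => MeasurableSet.of_discrete
  set S : Set (BondConfig (Fin n)) := {ω : BondConfig (Fin n) |
      2 * (A.filter fun a => ω ∈ openConn o a).card ≤ A.card} with hS
  have h := halfLeSevenForms_mul_measureReal_le_sum_inter (prodBernoulli w) A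
    (fun a => (openConn o a : Set (BondConfig (Fin n)))ᶜ) (fun a _ => hmeas _) (hmeas S)
    ((A.card : ℝ) / 2) ?_
  · exact h.trans (Finset.sum_le_sum fun a _ =>
      measureReal_mono Set.inter_subset_right (measure_ne_top _ _))
  intro ω hω
  have hind : ∀ a ∈ A, ((openConn o a : Set (BondConfig (Fin n)))ᶜ).indicator (fun _ => (1 : ℝ)) ω =
      if ¬ ω ∈ (openConn o a : Set (BondConfig (Fin n))) then (1 : ℝ) else 0 := by
    intro a _
    by_cases ha : ω ∈ (openConn o a : Set (BondConfig (Fin n)))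
    · rw [if_neg (not_not.2 ha), Set.indicator_of_notMem (Set.notMem_compl_iff.2 ha)]
    · rw [if_pos ha, Set.indicator_of_mem (show ω ∈ (openConn o a : Set (BondConfig (Fin n)))ᶜ
        from ha)]
  rw [Finset.sum_congr rfl hind, Finset.sum_boole]
  have hsplit := Finset.card_filter_add_card_filter_not (s := A)
    (fun a => ω ∈ (openConn o a : Set (BondConfig (Fin n))))
  have hcast : ((A.filter fun a => ω ∈ (openConn o a : Set (BondConfig (Fin n)))).card : ℝ) +
      ((A.filter fun a => ¬ ω ∈ (openConn o a : Set (BondConfig (Fin n)))).card : ℝ) = A.card := by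
    exact_mod_cast hsplit
  have h2 : (2 : ℝ) * ((A.filter fun a => ω ∈ (openConn o a : Set (BondConfig (Fin n)))).card : ℝ)
      ≤ A.card := by
    exact_mod_cast hω
  linarith

/-- **Fat minority ⊆ minority.** `P(d₀ < N ∧ 2N ≤ |A|) ≤ P(2N ≤ |A|)`. [folklore] -/
theorem fatMinority_le_minority {n : ℕ} (w : Sym2 (Fin n) → unitInterval)
    (A : Finset (Fin n)) (o : Fin n) (d₀ : ℕ) :
    (prodBernoulli w).real {ω : BondConfig (Fin n) |
        d₀ < (A.filter fun a => ω ∈ openConn o a).card ∧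
          2 * (A.filter fun a => ω ∈ openConn o a).card ≤ A.card} ≤
      (prodBernoulli w).real {ω : BondConfig (Fin n) |
        2 * (A.filter fun a => ω ∈ openConn o a).card ≤ A.card} :=
  measureReal_mono (fun _ hω => hω.2) (measure_ne_top _ _)

/-- **Minority bound from a bound on the missed relays.** If `A ≠ ∅` and
`P(o ↮ a) ≤ M` for every `a ∈ A`, then `P(2N ≤ |A|) ≤ 2M`. [folklore] -/
theorem minority_le_two_mul {n : ℕ} (w : Sym2 (Fin n) → unitInterval)
    (A : Finset (Fin n)) (o : Fin n) (hA : A.Nonempty) (M : ℝ)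
    (hM : ∀ a ∈ A, (prodBernoulli w).real (openConn o a : Set (BondConfig (Fin n)))ᶜ ≤ M) :
    (prodBernoulli w).real {ω : BondConfig (Fin n) |
        2 * (A.filter fun a => ω ∈ openConn o a).card ≤ A.card} ≤ 2 * M := by
  have h := fatMinority_halfCard_mul_le w A o
  have hsum : ∑ a ∈ A, (prodBernoulli w).real (openConn o a : Set (BondConfig (Fin n)))ᶜ ≤
      A.card * M := by
    calc ∑ a ∈ A, (prodBernoulli w).real (openConn o a : Set (BondConfig (Fin n)))ᶜ
        ≤ ∑ a ∈ A, M := Finset.sum_le_sum hM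
      _ = A.card * M := by simp
  have hpos : (0 : ℝ) < A.card := by exact_mod_cast Finset.card_pos.2 hA
  have hle : (A.card : ℝ) * ((1 / 2) * (prodBernoulli w).real {ω : BondConfig (Fin n) |
      2 * (A.filter fun a => ω ∈ openConn o a).card ≤ A.card}) ≤ A.card * M := by
    calc (A.card : ℝ) * ((1 / 2) * (prodBernoulli w).real {ω : BondConfig (Fin n) |
            2 * (A.filter fun a => ω ∈ openConn o a).card ≤ A.card})
        = ((A.card : ℝ) / 2) * (prodBernoulli w).real {ω : BondConfig (Fin n) |
            2 * (A.filter fun a => ω ∈ openConn o a).card ≤ A.card} := by ring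
      _ ≤ _ := h
      _ ≤ _ := hsum
  have := le_of_mul_le_mul_left hle hpos
  linarith

/-! ## Pair counting: the bounded-relay-set class -/

/-- On a configuration, the number of ordered pairs `(a, a') ∈ A × A` with `o ↔ a` and `o ↮ a'`
is `N · (|A| − N)`. [folklore] -/
theorem card_connPairs_eq {n : ℕ} (A : Finset (Fin n)) (o : Fin n) (ω : BondConfig (Fin n)) :
    ((A ×ˢ A).filter fun p : Fin n × Fin n =>
        ω ∈ (openConn o p.1 : Set (BondConfig (Fin n))) ∧
          ω ∉ (openConn o p.2 : Set (BondConfig (Fin n)))).card =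
      (A.filter fun a => ω ∈ openConn o a).card *
        (A.filter fun a => ¬ ω ∈ (openConn o a : Set (BondConfig (Fin n)))).card := by
  rw [← Finset.card_product]
  congr 1
  ext p
  simp only [Finset.mem_filter, Finset.mem_product]
  tauto

/-- **Pair counting.** If `P(a ↮ a') ≤ η` for all `a, a' ∈ A` then
`P(d₀ < N ∧ 2N ≤ |A|) ≤ (2|A| / (d₀+1)) · η`: on the event there are
`N(|A| − N) ≥ (d₀+1)|A|/2` ordered pairs `(a, a')` of relays with `o ↔ a`, `o ↮ a'`, each of which
is a disconnected pair, while `∑_{a,a'} P(a ↮ a') ≤ |A|² η`.  Hence the stub holds with constant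
`2K` on every class of relay sets with `|A| ≤ K (d₀ + 1)`; its content is the regime `|A| ≫ d₀`.
[folklore] -/
theorem fatMinority_pairCount {n : ℕ} (w : Sym2 (Fin n) → unitInterval) (A : Finset (Fin n))
    (o : Fin n) (d₀ : ℕ) (η : ℝ)
    (hpair : ∀ a ∈ A, ∀ a' ∈ A, (prodBernoulli w).real (openConn a a' : Set (BondConfig (Fin n)))ᶜ ≤ η) :
    (prodBernoulli w).real {ω : BondConfig (Fin n) |
        d₀ < (A.filter fun a => ω ∈ openConn o a).card ∧
          2 * (A.filter fun a => ω ∈ openConn o a).card ≤ A.card} ≤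
      2 * (A.card : ℝ) / (d₀ + 1) * η := by
  have hmeas : ∀ s : Set (BondConfig (Fin n)), MeasurableSet s :=
    fun _ => MeasurableSet.of_discrete
  rcases A.eq_empty_or_nonempty with hAe | hAne
  · subst hAe
    have hempty : {ω : BondConfig (Fin n) |
        d₀ < ((∅ : Finset (Fin n)).filter fun a => ω ∈ openConn o a).card ∧
          2 * ((∅ : Finset (Fin n)).filter fun a => ω ∈ openConn o a).card ≤
            (∅ : Finset (Fin n)).card} = ∅ := by
      ext ω
      simp
    rw [hempty, measureReal_empty]
    simp
  obtain ⟨a₁, ha₁⟩ := hAne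
  set P := prodBernoulli w with hP
  set F : Set (BondConfig (Fin n)) := {ω : BondConfig (Fin n) |
      d₀ < (A.filter fun a => ω ∈ openConn o a).card ∧
        2 * (A.filter fun a => ω ∈ openConn o a).card ≤ A.card} with hFdef
  have hη0 : 0 ≤ η := le_trans measureReal_nonneg (hpair a₁ ha₁ a₁ ha₁)
  set m : ℝ := (A.card : ℝ) with hm
  have hmpos : 0 < m := by rw [hm]; exact_mod_cast Finset.card_pos.2 ⟨a₁, ha₁⟩
  -- events indexed by ordered pairs
  let E : Fin n × Fin n → Set (BondConfig (Fin n)) := fun p =>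
    (openConn o p.1 : Set (BondConfig (Fin n))) ∩ (openConn o p.2 : Set (BondConfig (Fin n)))ᶜ
  have hcount : ((d₀ : ℝ) + 1) * (m / 2) * P.real F ≤ ∑ p ∈ A ×ˢ A, P.real (F ∩ E p) := by
    refine halfLeSevenForms_mul_measureReal_le_sum_inter P (A ×ˢ A) E (fun p _ => hmeas _) (hmeas _) _
      fun ω hω => ?_
    have hind : ∀ p ∈ A ×ˢ A, (E p).indicator (fun _ => (1 : ℝ)) ω =
        if (ω ∈ (openConn o p.1 : Set (BondConfig (Fin n))) ∧
          ω ∉ (openConn o p.2 : Set (BondConfig (Fin n)))) then (1 : ℝ) else 0 := by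
      intro p _
      by_cases hp : ω ∈ (openConn o p.1 : Set (BondConfig (Fin n))) ∧
          ω ∉ (openConn o p.2 : Set (BondConfig (Fin n)))
      · rw [if_pos hp, Set.indicator_of_mem (show ω ∈ E p from hp)]
      · rw [if_neg hp, Set.indicator_of_notMem (show ω ∉ E p from hp)]
    rw [Finset.sum_congr rfl hind, Finset.sum_boole, card_connPairs_eq A o ω]
    obtain ⟨h1, h2⟩ := hω
    have hsplit := Finset.card_filter_add_card_filter_not (s := A)
      (fun a => ω ∈ (openConn o a : Set (BondConfig (Fin n))))
    set N := (A.filter fun a => ω ∈ openConn o a).card with hN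
    set N' := (A.filter fun a => ¬ ω ∈ (openConn o a : Set (BondConfig (Fin n)))).card with hN'
    have hcast : (N : ℝ) + N' = m := by rw [hm]; exact_mod_cast hsplit
    have h1' : (d₀ : ℝ) + 1 ≤ N := by exact_mod_cast h1
    have h2' : 2 * (N : ℝ) ≤ m := by rw [hm]; exact_mod_cast h2
    have hN'ge : m / 2 ≤ (N' : ℝ) := by linarith
    push_cast
    calc ((d₀ : ℝ) + 1) * (m / 2) ≤ (N : ℝ) * N' :=
          mul_le_mul h1' hN'ge (by positivity) (by positivity)
      _ = (N : ℝ) * N' := rfl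
  have hsum : ∑ p ∈ A ×ˢ A, P.real (F ∩ E p) ≤ m * m * η := by
    calc ∑ p ∈ A ×ˢ A, P.real (F ∩ E p)
        ≤ ∑ p ∈ A ×ˢ A, η := by
          refine Finset.sum_le_sum fun p hp => ?_
          rw [Finset.mem_product] at hp
          calc P.real (F ∩ E p) ≤ P.real (E p) :=
                measureReal_mono Set.inter_subset_right (measure_ne_top _ _)
            _ ≤ P.real (openConn p.1 p.2 : Set (BondConfig (Fin n)))ᶜ := by
                refine measureReal_mono (fun ω' hω' => ?_) (measure_ne_top _ _)
                rintro (h12 : (openGraph ω').Reachable p.1 p.2)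
                have ho1 : (openGraph ω').Reachable o p.1 := hω'.1
                exact hω'.2 (ho1.trans h12)
            _ ≤ η := hpair p.1 hp.1 p.2 hp.2
      _ = m * m * η := by
          rw [Finset.sum_const, Finset.card_product, nsmul_eq_mul]
          push_cast
          rw [hm]
  have hkey : ((d₀ : ℝ) + 1) * (m / 2) * P.real F ≤ m * m * η := hcount.trans hsum
  -- divide by `(d₀+1) m / 2 > 0`
  have hd : (0 : ℝ) < (d₀ : ℝ) + 1 := by positivity
  rw [show 2 * m / ((d₀ : ℝ) + 1) * η = (m * m * η) / (((d₀ : ℝ) + 1) * (m / 2)) by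
    field_simp]
  rw [le_div_iff₀ (by positivity)]
  linarith

end Summit.CriticalPhenomena.PercolationContinuityZ3.Theorems

end
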